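import Mathlib.Topology.Algebra.Module.FiniteDimension
import Literature.IUT.LogVolume.TensorPacketMeasure
import Literature.IUT.LogVolume.PadicLinearLatticeVolume
import Literature.IUT.LogVolume.FundamentalIdentity
import HarnessLib

/-!
# (Ind1) on a tensor packet: permuting the tensor factors, and the invariance of the normalised
# log Haar measure (Dupuy–Hilado §4.7; [IUTchI] Prop. 4.11 (i) via [IUTchIII] Thm. 3.11 (i))

Dupuy–Hilado, arXiv:2004.13228 (pre-split text) §4.7 "Formula for Ind1", read on the page (render chunk 15):
"if `f_j = f_j(γ) : {0,…,j} → {0,…,j}` is the underlying permutation of the `j`th capsule in the automorphism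
then on the summand `K_{v̲_0} ⊗ ⋯ ⊗ K_{v̲_j}` we have `K_{v̲_0} ⊗ ⋯ ⊗ K_{v̲_j} → K_{v̲_{f_j^{−1}(0)}} ⊗ ⋯ ⊗
K_{v̲_{f_j^{−1}(j)}} ⊂ 𝔸^{⊗ j+1}_{V̲,p}` which acts on simple tensors as `x_0 ⊗ ⋯ ⊗ x_j ↦ x_{f_j^{−1}(j)} ⊗ ⋯ ⊗
x_{f_j^{−1}(0)}`. This map is `ℚ_p`-linear and fixes the lattice `⊕ I_{(v̲_0,…,v̲_j)} ⊂ 𝕃_{p,j}`."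

WHAT THIS FILE DOES. For a family `s : I → Type` of fields of the cell's MLF class and a permutation
`σ ∈ S_I`, the factor permutation between the packets `⊗_i s_{σ(i)}` and `⊗_i s_i`:

* `permAlgEquiv p s σ : PacketAlgebra p (fun i ↦ s (σ i)) ≃ₐ[ℚ_p] PacketAlgebra p s` — Mathlib's
  `PiTensorProduct.reindex` upgraded to a `ℚ_p`-ALGEBRA isomorphism (multiplicativity on pure tensors),
  with `permAlgEquiv_tprod` (a pure tensor goes to the re-indexed pure tensor, `Equiv.piCongrLeft`) and
  `permAlgEquiv_one_apply` (the identity permutation acts as the identity);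
* it maps generators to generators, hence **`log_p(R_I^×)` onto `log_p(R_I^×)`** (`image_logPacket_perm` —
  "fixes the lattice") and, preserving `ℤ_p`-integrality, **`(R_I)^∼` onto `(R_I)^∼`** (`image_normalizedPacket_perm`);
* **the modelling field `logμ_perm` of `IndPacketModel` PROVED**: with the chosen decompositions
  `ψ' : ⊗ s_{σ(i)} ≃ Π L'`, `ψ : ⊗ s_i ≃ Π L` of `TensorPacketMeasure.lean`, the composite `ψ ∘ perm ∘ ψ'⁻¹` is
  a `ℚ_p`-linear isomorphism `⊕ L' ≃ ⊕ L` carrying the unit polydisc onto the unit polydisc, so it carries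
  the normalised Haar measure of `⊕ L'` to that of `⊕ L` (`PadicModule.haar_image_linearEquiv_of_image_eq`,
  seat abc-iut-c312-d1): `packetVol_image_perm`, `packetAdm_image_perm`, and — the two packets having the
  same `ℚ_p`-dimension `D = Σ e_j f_j` (`packetDegree_eq_finrank`, S1's fundamental identity
  `e·f = [L:ℚ_p]`) — `packetLogμ_image_perm : log μ̄(perm(A)) = log μ̄(A)` for EVERY `A`.

[cite: DupuyHilado2025, §4.7] [cite: Mochizuki2012, IUTchIII Thm. 3.11 (i) p. 154]
Deliberately NOT here: the (Ind1) transport at the level of a whole model (`TensorPacketModel.lean`),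
capsules/processions as categories, anything about Cor. 3.12.
-/

noncomputable section

open MeasureTheory Set Metric
open scoped TensorProduct NormedField Pointwise ENNReal

namespace Literature.IUT.LogVolume

open Literature.NumberTheory.GaloisRepresentations.Ultrametric

variable (p : ℕ) [Fact p.Prime]
variable {I : Type} [Fintype I] [DecidableEq I]
variable (s : I → Type) [∀ i, NontriviallyNormedField (s i)] [∀ i, NormedAlgebra ℚ_[p] (s i)]
  [∀ i, IsUltrametricDist (s i)] [∀ i, ProperSpace (s i)]
variable (σ : Equiv.Perm I)

/-! ## The factor permutation as an algebra isomorphism -/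

section Perm

omit [Fintype I] [DecidableEq I] [∀ i, IsUltrametricDist (s i)] [∀ i, ProperSpace (s i)]

/-- The factor permutation as a LINEAR isomorphism: the inverse of Mathlib's re-indexing of `⊗_i s_i`
along `σ⁻¹` (whose target `⊗_i s_{(σ⁻¹)⁻¹(i)}` is, definitionally, `⊗_i s_{σ(i)}`).
[cite: DupuyHilado2025, §4.7] -/
def permLinearEquiv : PacketAlgebra p (fun i ↦ s (σ i)) ≃ₗ[ℚ_[p]] PacketAlgebra p s :=
  (PiTensorProduct.reindex ℚ_[p] s σ.symm).symm

/-- `reindex σ⁻¹ ∘ perm = id` (the definitional unfolding, stated once; all later proofs go through it).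
[cite: DupuyHilado2025, §4.7] -/
theorem reindex_permLinearEquiv_apply (x : PacketAlgebra p (fun i ↦ s (σ i))) :
    PiTensorProduct.reindex ℚ_[p] s σ.symm (permLinearEquiv p s σ x) = x :=
  (PiTensorProduct.reindex ℚ_[p] s σ.symm).apply_symm_apply x

/-- **On pure tensors**: `perm(⊗_a z_a) = ⊗_b x_b` with `x_{σ(a)} = z_a` ("`x_0 ⊗ ⋯ ⊗ x_j ↦ x_{f^{−1}(0)} ⊗ ⋯`";
written with `Equiv.piCongrLeft`, which is cast-free). [cite: DupuyHilado2025, §4.7] -/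
theorem permLinearEquiv_tprod (z : Π i, s (σ i)) :
    permLinearEquiv p s σ (PiTensorProduct.tprod ℚ_[p] z) =
      PiTensorProduct.tprod ℚ_[p] (Equiv.piCongrLeft s σ z) := by
  apply (PiTensorProduct.reindex ℚ_[p] s σ.symm).injective
  refine (reindex_permLinearEquiv_apply p s σ _).trans ?_
  refine Eq.trans ?_
    (PiTensorProduct.reindex_tprod (R := ℚ_[p]) (s := s) σ.symm (Equiv.piCongrLeft s σ z)).symm
  exact congrArg (PiTensorProduct.tprod ℚ_[p])
    (funext fun a => (Equiv.piCongrLeft_apply_apply s σ z a).symm)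

/-- The re-indexing is multiplicative. [cite: DupuyHilado2025, §4.7] -/
theorem reindex_symm_map_mul (x y : PacketAlgebra p s) :
    PiTensorProduct.reindex ℚ_[p] s σ.symm (x * y) =
      PiTensorProduct.reindex ℚ_[p] s σ.symm x * PiTensorProduct.reindex ℚ_[p] s σ.symm y := by
  induction x using PiTensorProduct.induction_on with
  | smul_tprod r f =>
    induction y using PiTensorProduct.induction_on with
    | smul_tprod r' g =>
      rw [PiTensorProduct.smul_tprod_mul_smul_tprod, map_smul, map_smul, map_smul,
        PiTensorProduct.reindex_tprod, PiTensorProduct.reindex_tprod, PiTensorProduct.reindex_tprod,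
        PiTensorProduct.smul_tprod_mul_smul_tprod]
      rfl
    | add a b ha hb => rw [mul_add, map_add, ha, hb, map_add, mul_add]
  | add a b ha hb => rw [add_mul, map_add, ha, hb, map_add, add_mul]

/-- Hence so is its inverse. [cite: DupuyHilado2025, §4.7] -/
theorem permLinearEquiv_map_mul (x y : PacketAlgebra p (fun i ↦ s (σ i))) :
    permLinearEquiv p s σ (x * y) = permLinearEquiv p s σ x * permLinearEquiv p s σ y := by
  apply (PiTensorProduct.reindex ℚ_[p] s σ.symm).injective
  refine (reindex_permLinearEquiv_apply p s σ _).trans ?_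
  refine Eq.trans ?_ (reindex_symm_map_mul p s σ _ _).symm
  exact congrArg₂ (· * ·) (reindex_permLinearEquiv_apply p s σ x).symm
    (reindex_permLinearEquiv_apply p s σ y).symm

/-- `perm(1) = 1`. [cite: DupuyHilado2025, §4.7] -/
theorem permLinearEquiv_map_one : permLinearEquiv p s σ 1 = 1 := by
  have h : (1 : PacketAlgebra p (fun i ↦ s (σ i))) = PiTensorProduct.tprod ℚ_[p] 1 :=
    PiTensorProduct.one_def
  rw [h, permLinearEquiv_tprod, PiTensorProduct.one_def]
  refine congrArg (PiTensorProduct.tprod ℚ_[p]) (funext fun b => ?_)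
  obtain ⟨a, rfl⟩ := σ.surjective b
  rw [Equiv.piCongrLeft_apply_apply]
  rfl

/-- **The (Ind1) factor permutation** `⊗_i s_{σ(i)} ≃ ⊗_i s_i` as a `ℚ_p`-ALGEBRA isomorphism.
[cite: DupuyHilado2025, §4.7] -/
def permAlgEquiv : PacketAlgebra p (fun i ↦ s (σ i)) ≃ₐ[ℚ_[p]] PacketAlgebra p s :=
  AlgEquiv.ofLinearEquiv (permLinearEquiv p s σ) (permLinearEquiv_map_one p s σ)
    (permLinearEquiv_map_mul p s σ)

/-- `permAlgEquiv` acts as `permLinearEquiv`. [cite: DupuyHilado2025, §4.7] -/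
@[simp] theorem permAlgEquiv_apply (x : PacketAlgebra p (fun i ↦ s (σ i))) :
    permAlgEquiv p s σ x = permLinearEquiv p s σ x := rfl

/-- On pure tensors (`purePacket` form). [cite: DupuyHilado2025, §4.7] -/
theorem permAlgEquiv_purePacket (z : Π i, s (σ i)) :
    permAlgEquiv p s σ (purePacket p (fun i ↦ s (σ i)) z) = purePacket p s (Equiv.piCongrLeft s σ z) :=
  permLinearEquiv_tprod p s σ z

/-- **The identity permutation acts as the identity** (`IndPacketModel.perm_one`).
[cite: DupuyHilado2025, §4.7] -/
theorem permAlgEquiv_one_apply (x : PacketAlgebra p s) : permAlgEquiv p s (1 : Equiv.Perm I) x = x := by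
  rw [permAlgEquiv_apply]
  induction x using PiTensorProduct.induction_on with
  | smul_tprod r f =>
    refine (map_smul (permLinearEquiv p s (1 : Equiv.Perm I)) r _).trans ?_
    refine congrArg (fun v : PacketAlgebra p s => r • v) ?_
    refine (permLinearEquiv_tprod p s (1 : Equiv.Perm I) f).trans ?_
    exact congrArg (PiTensorProduct.tprod ℚ_[p])
      (funext fun b => Equiv.piCongrLeft_apply_apply s (1 : Equiv.Perm I) f b)
  | add a b ha hb =>
    exact ((map_add (permLinearEquiv p s (1 : Equiv.Perm I)) a b).trans (congrArg₂ (· + ·) ha hb))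

end Perm

/-! ## (Ind1) "fixes the lattice": images of `log_p(R_I^×)` and `(R_I)^∼` -/

section Images

omit [Fintype I] [DecidableEq I] [∀ i, IsUltrametricDist (s i)] [∀ i, ProperSpace (s i)] in
/-- The generating pure tensors of `log_p(R_I^×)` correspond under the permutation.
[cite: DupuyHilado2025, §4.7] -/
theorem image_logPacket_generators :
    permAlgEquiv p s σ ''
        {t | ∃ z : Π i, s (σ i), (∀ i, z i ∈ logUnits (s (σ i))) ∧ t = purePacket p (fun i ↦ s (σ i)) z} =
      {t | ∃ x : Π i, s i, (∀ i, x i ∈ logUnits (s i)) ∧ t = purePacket p s x} := by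
  ext t
  constructor
  · rintro ⟨_, ⟨z, hz, rfl⟩, rfl⟩
    refine ⟨Equiv.piCongrLeft s σ z, fun b => ?_, permAlgEquiv_purePacket p s σ z⟩
    obtain ⟨a, rfl⟩ := σ.surjective b
    rw [Equiv.piCongrLeft_apply_apply]
    exact hz a
  · rintro ⟨x, hx, rfl⟩
    refine ⟨purePacket p (fun i ↦ s (σ i)) (fun a => x (σ a)), ⟨_, fun a => hx (σ a), rfl⟩, ?_⟩
    rw [permAlgEquiv_purePacket]
    congr 1
    funext b
    obtain ⟨a, rfl⟩ := σ.surjective b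
    rw [Equiv.piCongrLeft_apply_apply]

omit [Fintype I] [DecidableEq I] [∀ i, IsUltrametricDist (s i)] [∀ i, ProperSpace (s i)] in
/-- **(Ind1) "fixes the lattice"**: the factor permutation maps `log_p(R_I^×) = ⊗ log_p(R^×_{σ(i)})` ONTO
`⊗ log_p(R_i^×)`. [cite: DupuyHilado2025, §4.7] -/
theorem image_logPacket_perm :
    permAlgEquiv p s σ '' (logPacket p (fun i ↦ s (σ i)) : Set (PacketAlgebra p (fun i ↦ s (σ i)))) =
      logPacket p s := by
  have h := AddMonoidHom.map_closure
    ((permAlgEquiv p s σ : PacketAlgebra p (fun i ↦ s (σ i)) ≃ₐ[ℚ_[p]] PacketAlgebra p s) :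
      PacketAlgebra p (fun i ↦ s (σ i)) →+ PacketAlgebra p s)
    {t | ∃ z : Π i, s (σ i), (∀ i, z i ∈ logUnits (s (σ i))) ∧ t = purePacket p (fun i ↦ s (σ i)) z}
  have h' := congrArg (fun H : AddSubgroup (PacketAlgebra p s) => (H : Set (PacketAlgebra p s))) h
  simp only [AddSubgroup.coe_map] at h'
  rw [logPacket, logPacket, ← image_logPacket_generators p s σ]
  exact h'

omit [Fintype I] [DecidableEq I] [∀ i, IsUltrametricDist (s i)] [∀ i, ProperSpace (s i)] in
/-- The factor permutation commutes with scalars on subsets: `perm(c·A) = c·perm(A)`.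
[cite: DupuyHilado2025, §4.7] -/
theorem image_const_smul_perm (c : ℚ_[p]) (A : Set (PacketAlgebra p (fun i ↦ s (σ i)))) :
    permAlgEquiv p s σ '' (c • A) = c • permAlgEquiv p s σ '' A := by
  rw [← image_smul, ← image_smul, image_image, image_image]
  exact image_congr fun a _ => by rw [permAlgEquiv_apply, permAlgEquiv_apply, map_smul]

variable [Nonempty I]

omit [DecidableEq I] in
/-- **(Ind1) maps `O` to `O`**: the factor permutation, a `ℚ_p`-algebra isomorphism, preserves
`ℤ_p`-integrality both ways, hence maps `(R_I)^∼` ONTO `(R_I)^∼` (abc-iut-S5's characterisation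
`(R_I)^∼ = {ℤ_p-integral elements}`). [cite: DupuyHilado2025, §4.7] -/
theorem image_normalizedPacket_perm :
    permAlgEquiv p s σ ''
        (normalizedPacket p (fun i ↦ s (σ i)) : Set (PacketAlgebra p (fun i ↦ s (σ i)))) =
      normalizedPacket p s := by
  ext y
  constructor
  · rintro ⟨x, hx, rfl⟩
    rw [SetLike.mem_coe, mem_normalizedPacket_iff_isIntegral]
    rw [SetLike.mem_coe, mem_normalizedPacket_iff_isIntegral] at hx
    exact hx.map (permAlgEquiv p s σ : PacketAlgebra p (fun i ↦ s (σ i)) →ₐ[ℚ_[p]] PacketAlgebra p s)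
  · intro hy
    refine ⟨(permAlgEquiv p s σ).symm y, ?_, (permAlgEquiv p s σ).apply_symm_apply y⟩
    rw [SetLike.mem_coe, mem_normalizedPacket_iff_isIntegral]
    rw [SetLike.mem_coe, mem_normalizedPacket_iff_isIntegral] at hy
    exact hy.map ((permAlgEquiv p s σ).symm : PacketAlgebra p s →ₐ[ℚ_[p]] PacketAlgebra p (fun i ↦ s (σ i)))

end Images

/-! ## The degree `D` is the `ℚ_p`-dimension; (Ind1) preserves the normalised log Haar measure -/

section Degree

variable {J : Type} [Fintype J] (L : J → Type) [∀ j, NontriviallyNormedField (L j)]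
  [∀ j, NormedAlgebra ℚ_[p] (L j)] [∀ j, IsUltrametricDist (L j)] [∀ j, ProperSpace (L j)]

/-- **`D = Σ_j e_j f_j = dim_{ℚ_p} ⊕_j L_j`** (the fundamental identity `e·f = [L:ℚ_p]` in each factor).
[cite: Mochizuki2012, IUTchIV Prop. 1.4 (i) p. 13] -/
theorem packetDegree_eq_finrank : packetDegree p L = Module.finrank ℚ_[p] (Π j, L j) := by
  haveI : ∀ j, FiniteDimensional ℚ_[p] (L j) := fun j => FiniteDimensional.of_locallyCompactSpace ℚ_[p]
  rw [packetDegree, Module.finrank_pi_fintype]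
  exact Finset.sum_congr rfl fun j _ => absRamificationIdx_mul_residueDegree p (L j)

end Degree

section Volume

variable [Nonempty I]

omit [DecidableEq I] [∀ i, IsUltrametricDist (s i)] [Nonempty I] in
/-- The degree of a packet is its `ℚ_p`-dimension: `D(⊗ s_i) = dim_{ℚ_p} ⊗ s_i`.
[cite: Mochizuki2012, IUTchIV Prop. 1.4 (i) p. 13] -/
theorem packetDegree_dFac_eq : packetDegree p (DFac p s) = Module.finrank ℚ_[p] (PacketAlgebra p s) := by
  rw [packetDegree_eq_finrank, ← (dEquiv p s).toLinearEquiv.finrank_eq]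

omit [DecidableEq I] [∀ i, IsUltrametricDist (s i)] [Nonempty I] in
/-- The two packets `⊗ s_{σ(i)}`, `⊗ s_i` have the same degree. [cite: DupuyHilado2025, §4.7] -/
theorem packetDegree_perm_eq :
    packetDegree p (DFac p (fun i ↦ s (σ i))) = packetDegree p (DFac p s) := by
  rw [packetDegree_dFac_eq, packetDegree_dFac_eq, (permAlgEquiv p s σ).toLinearEquiv.finrank_eq]

omit [DecidableEq I] [∀ i, IsUltrametricDist (s i)] [Nonempty I] in
/-- The conjugate `ψ ∘ perm ∘ ψ'⁻¹ : ⊕ L' ≃ ⊕ L` applied to `ψ'(A)` is `ψ(perm(A))`. [folklore] -/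
private theorem image_conj_perm (A : Set (PacketAlgebra p (fun i ↦ s (σ i)))) :
    ((dEquiv p (fun i ↦ s (σ i))).toLinearEquiv.symm.trans
        ((permAlgEquiv p s σ).toLinearEquiv.trans (dEquiv p s).toLinearEquiv)) ''
        (dEquiv p (fun i ↦ s (σ i)) '' A) =
      dEquiv p s '' (permAlgEquiv p s σ '' A) := by
  rw [image_image, image_image]
  refine image_congr fun a _ => ?_
  simp

/-- **(Ind1) preserves the normalised Haar measure** (`IndPacketModel.perm_adm`/`logμ_perm`, the MODELLING
fields, as THEOREMS): `μ(perm(A)) = μ'(A)` for every `A`, the measures being normalised by the unit polydiscs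
`ψ((R_I)^∼)`, `ψ'((R_I)^∼)`, which correspond under `ψ ∘ perm ∘ ψ'⁻¹`. [cite: DupuyHilado2025, §4.7] -/
theorem packetVol_image_perm (A : Set (PacketAlgebra p (fun i ↦ s (σ i)))) :
    packetVol p s (permAlgEquiv p s σ '' A) = packetVol p (fun i ↦ s (σ i)) A := by
  haveI : IsModuleTopology ℚ_[p] (DSum p s) := isModuleTopologyOfFiniteDimensional
  haveI : IsModuleTopology ℚ_[p] (DSum p (fun i ↦ s (σ i))) := isModuleTopologyOfFiniteDimensional
  let Φ := (dEquiv p (fun i ↦ s (σ i))).toLinearEquiv.symm.trans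
    ((permAlgEquiv p s σ).toLinearEquiv.trans (dEquiv p s).toLinearEquiv)
  have hΦ : Φ '' (piUnitBallStructure (DFac p (fun i ↦ s (σ i))) : Set (DSum p (fun i ↦ s (σ i)))) =
      (piUnitBallStructure (DFac p s) : Set (DSum p s)) := by
    rw [← image_normalizedPacket_eq_coe, image_conj_perm, image_normalizedPacket_perm,
      image_normalizedPacket_eq_coe]
  unfold packetVol
  rw [← image_conj_perm]
  exact PadicModule.haar_image_linearEquiv_of_image_eq p _ _ Φ hΦ _

/-- (Ind1) preserves admissibility. [cite: DupuyHilado2025, §4.7] -/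
theorem packetAdm_image_perm {A : Set (PacketAlgebra p (fun i ↦ s (σ i)))}
    (hA : PacketAdm p (fun i ↦ s (σ i)) A) : PacketAdm p s (permAlgEquiv p s σ '' A) := by
  unfold PacketAdm
  rw [packetVol_image_perm]
  exact hA

/-- **(Ind1) preserves `log μ̄`** of every subset (same measure, same degree).
[cite: DupuyHilado2025, §4.7] -/
theorem packetLogμ_image_perm (A : Set (PacketAlgebra p (fun i ↦ s (σ i)))) :
    packetLogμ p s (permAlgEquiv p s σ '' A) = packetLogμ p (fun i ↦ s (σ i)) A := by
  have h := packetVol_image_perm p s σ A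
  unfold packetVol at h
  simp only [packetLogμ_eq, IntegralStructure.normalizedLogVolume, IntegralStructure.logVolume, h,
    packetDegree_perm_eq]

end Volume

end Literature.IUT.LogVolume

end
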